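import Summits.BirchSwinnertonDyer.BirchSwinnertonDyer.Theorems.Rank2ObservatoryRank3CMCensus
import Summits.BirchSwinnertonDyer.BirchSwinnertonDyer.Theorems.Rank2ObservatoryRank3ConductorTotal
import Summits.BirchSwinnertonDyer.BirchSwinnertonDyer.Theorems.Rank2ObservatoryRank3Row0ByName
import Literature.NumberTheory.DiophantineGeometry.PastenValuationProductsProofs
import Literature.NumberTheory.DiophantineGeometry.GeneralizedFermatTwoPowerCoefficientFreySaitoProofs
import HarnessLib

/-!
# BirchSwinnertonDyer — rank ≥ 2 observatory: the SEMISTABILITY CENSUS of the rank-3 table —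
# `4 595` semistable / `4 892` not, decided in the kernel per row, hypothesis-free

HONEST FRAMING: per-curve certified theorems and census instruments; no claim on BSD in rank ≥ 2.

Cell `b2b-bsdr2` (run/shared/lean/b2b/bsd-rank2-observatory/), cert-2 = the rank-3 arm, gen 60; ONE
zero-kit file (no data beyond the 126 primes below `708`), kernel-census-index row 52. Semistability
("good or multiplicative reduction at every prime", `WeierstrassCurve.IsSemistable`) is the standing
hypothesis of a whole family of instruments the observatory reads per curve — Serre 1972 §5.4 Prop. 21
(`E[p]` irreducible ⇒ `ρ̄_{E,p}` onto, the big-image input of Kato / Skinner–Urban / Kolyvagin; row 53),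
the semistable `p`-converse and main-conjecture slices, Mazur's Manin-constant theorem — and until now no
row of the rank-3 census table `rank3Table` (all `9 487` curves of rank `3` and conductor `N < 500 000`
in Cremona's table) carried it. This file DECIDES it for every row, by name:

* `E` is semistable iff `N_E` is squarefree — Silverman ATAEC IV.10.2 (`f_p = 0` iff good, `f_p = 1` iff
  multiplicative), a THEOREM of the tree (`WeierstrassCurve.isSemistable_iff_squarefree_conductorNorm`);
  and `N_E = r.N` for every row (`Rank3Row.conductorNorm_eq_of_mem`, the census's kernel-checked Tate
  certificates, row 9 of the index).
* §1 Squarefreeness of `n < 708² = 501 264` is DECIDED by the `126` prime squares below `708²`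
  (`sqfree708B`; sound AND complete: `squarefree_of_sqfree708B`, `not_squarefree_of_sqfree708B_false`;
  the cover `sqTestPrimes_cover` is itself a kernel `decide`, primality is never used). (The table's
  data-integrity test `squarefreeB` of `Rank2ObservatoryRank3Table` is one-sided and fuelled by `n`; this
  one is two-sided and costs `126` remainders per row.)
* §2 `Rank3Row.semistableB` decides `IsSemistable ℤ` (and `IsSemistable (𝓞 ℚ)`) per row
  (`isSemistable_iff_semistableB`, `isSemistable_of_mem`, `not_isSemistable_of_mem`); KERNEL CENSUS
  (`decide +kernel`, two linear walks): exactly `4 595` rows are semistable and `4 892` are not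
  (`rank3Table_countP_semistableB`, `rank3Table_countP_not_semistableB`); the six CM rows are not
  (`cmRows_semistableB`, `not_isSemistable_of_mem_cmRows` — consistent with row 48's "no multiplicative
  prime"); row `0` = `5077a1` (`N = 5077` prime) is, by name on `Curve5077a.E` (`curve5077a_isSemistable`).
* §3 Summary `rank3_semistableCensus`.

Per curve; NOT a class theorem; no census verdict and no BSD statement is changed by this file.

## References

* J. H. Silverman, Advanced Topics in the Arithmetic of Elliptic Curves (1994), IV.10.2. [Silverman1994]
* J. E. Cremona, Algorithms for Modular Elliptic Curves (1997), Tables. [CremonaAlgorithms1997]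
* J. Buhler, B. Gross, D. Zagier, Math. Comp. 44 (1985), §1 eq. (2). [BuhlerGrossZagier1985]
-/

set_option linter.dupNamespace false
set_option autoImplicit false

-- single-conjunct summit: `Summit.BirchSwinnertonDyer.BirchSwinnertonDyer.…` repeats the name by design
namespace Summit.BirchSwinnertonDyer.BirchSwinnertonDyer.Rank2Observatory

open Literature Literature.NumberTheory.EllipticCurves Literature.NumberTheory.DiophantineGeometry
open WeierstrassCurve
open scoped NumberField

/-! ### §1 Deciding squarefreeness below `708²` by the 126 prime squares -/

/-- The `126` primes below `708` (primality is not used: only that every `2 ≤ m < 708` has a divisor in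
the list, `sqTestPrimes_cover`). [folklore] -/
def sqTestPrimes : List ℕ :=
  [2, 3, 5, 7, 11, 13, 17, 19, 23, 29, 31, 37, 41, 43, 47, 53, 59, 61, 67, 71, 73, 79, 83, 89, 97, 101,
    103, 107, 109, 113, 127, 131, 137, 139, 149, 151, 157, 163, 167, 173, 179, 181, 191, 193, 197, 199,
    211, 223, 227, 229, 233, 239, 241, 251, 257, 263, 269, 271, 277, 281, 283, 293, 307, 311, 313, 317,
    331, 337, 347, 349, 353, 359, 367, 373, 379, 383, 389, 397, 401, 409, 419, 421, 431, 433, 439, 443,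
    449, 457, 461, 463, 467, 479, 487, 491, 499, 503, 509, 521, 523, 541, 547, 557, 563, 569, 571, 577,
    587, 593, 599, 601, 607, 613, 617, 619, 631, 641, 643, 647, 653, 659, 661, 673, 677, 683, 691, 701]

/-- Every `m < 708` with `2 ≤ m` has a divisor in `sqTestPrimes` (kernel). [folklore] -/
theorem sqTestPrimes_cover : ∀ m < 708, m < 2 ∨ ∃ p ∈ sqTestPrimes, p ∣ m := by
  decide +kernel

/-- The listed numbers are `≥ 2` (so none is a unit). [folklore] -/
theorem two_le_of_mem_sqTestPrimes : ∀ p ∈ sqTestPrimes, 2 ≤ p := by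
  decide +kernel

/-- The two-sided squarefreeness test below `708² = 501 264`: no listed prime square divides `n`.
[folklore] -/
def sqfree708B (n : ℕ) : Bool :=
  sqTestPrimes.all fun p => n % (p * p) != 0

/-- **Soundness**: for `n < 708²`, a passing test means `n` is squarefree (an `x ≥ 2` with `x² ∣ n` has
`x < 708`, hence a listed divisor `p`, and `p² ∣ x² ∣ n`). [folklore] -/
theorem squarefree_of_sqfree708B {n : ℕ} (hn : n < 708 * 708) (h : sqfree708B n = true) :
    Squarefree n := by
  have h' : ∀ p ∈ sqTestPrimes, n % (p * p) ≠ 0 := by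
    intro p hp
    have := List.all_eq_true.mp h p hp
    simpa using this
  intro x hx
  by_contra hux
  have hn0 : n ≠ 0 := by
    rintro rfl
    exact h' 2 (by decide) (by decide)
  have hx0 : x ≠ 0 := by
    rintro rfl
    rw [mul_zero, zero_dvd_iff] at hx
    exact hn0 hx
  have hx1 : x ≠ 1 := fun h1 => hux (h1 ▸ isUnit_one)
  have hxle : x * x ≤ n := Nat.le_of_dvd (Nat.pos_of_ne_zero hn0) hx
  have hxlt : x < 708 := by
    by_contra hge
    have hge' : 708 ≤ x := not_lt.mp hge
    have : 708 * 708 ≤ x * x := Nat.mul_le_mul hge' hge'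
    omega
  rcases sqTestPrimes_cover x hxlt with hlt2 | ⟨p, hp, hpx⟩
  · omega
  · exact h' p hp (Nat.mod_eq_zero_of_dvd ((mul_dvd_mul hpx hpx).trans hx))

/-- **Completeness**: a failing test exhibits a listed `p ≥ 2` with `p² ∣ n`, so `n` is not squarefree.
[folklore] -/
theorem not_squarefree_of_sqfree708B_false {n : ℕ} (h : sqfree708B n = false) : ¬ Squarefree n := by
  intro hsq
  have h' : ∃ p ∈ sqTestPrimes, n % (p * p) = 0 := by
    by_contra hne
    have hall : sqfree708B n = true := List.all_eq_true.mpr fun p hp => by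
      have hp' : n % (p * p) ≠ 0 := fun h0 => hne ⟨p, hp, h0⟩
      simpa using hp'
    rw [h] at hall
    exact Bool.false_ne_true hall
  obtain ⟨p, hp, hmod⟩ := h'
  have hunit : IsUnit p := hsq p (Nat.dvd_of_mod_eq_zero hmod)
  rw [Nat.isUnit_iff] at hunit
  have := two_le_of_mem_sqTestPrimes p hp
  omega

/-- Below `708²` the test decides squarefreeness. [folklore] -/
theorem squarefree_iff_sqfree708B {n : ℕ} (hn : n < 708 * 708) : Squarefree n ↔ sqfree708B n = true := by
  refine ⟨fun hs => ?_, squarefree_of_sqfree708B hn⟩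
  cases h : sqfree708B n
  · exact absurd hs (not_squarefree_of_sqfree708B_false h)
  · rfl

/-! ### §2 The semistability census of the rank-3 table (kernel, hypothesis-free) -/

namespace Rank3Row

/-- The row's semistability test: `N` squarefree, by the 126 prime squares (`N < 500 000 < 708²`).
[cite: Silverman1994, IV.10.2] -/
def semistableB (r : Rank3Row) : Bool :=
  sqfree708B r.N

end Rank3Row

/-- For a census row, `N` is squarefree iff the test passes (`N < 500 000`, `rank3Table_conductor_lt`).
[cite: CremonaAlgorithms1997, Tables] -/
theorem squarefree_N_iff_semistableB {r : Rank3Row} (hr : r ∈ rank3Table) :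
    Squarefree r.N ↔ r.semistableB = true := by
  have hlt : r.N < 500000 := of_decide_eq_true (List.all_eq_true.mp rank3Table_conductor_lt r hr)
  exact squarefree_iff_sqfree708B (by omega)

/-- **Semistability decided per row, hypothesis-free**: a rank-3 census curve is semistable (good or
multiplicative reduction everywhere, `IsSemistable ℤ`) iff its row passes `semistableB` — by ATAEC
IV.10.2 (`isSemistable_iff_squarefree_conductorNorm`, PROVED in the tree) and the census's conductor
certificate `N_E = r.N` (`Rank3Row.conductorNorm_eq_of_mem`). [cite: Silverman1994, IV.10.2] -/
theorem isSemistable_iff_semistableB {r : Rank3Row} (hr : r ∈ rank3Table) :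
    r.curve.IsSemistable ℤ ↔ r.semistableB = true := by
  haveI := isElliptic_of_mem hr
  rw [r.curve.isSemistable_iff_squarefree_conductorNorm, Rank3Row.conductorNorm_eq_of_mem hr,
    squarefree_N_iff_semistableB hr]

/-- The `4 595` passing rows are semistable over `ℤ`. [cite: Silverman1994, IV.10.2] -/
theorem isSemistable_of_mem {r : Rank3Row} (hr : r ∈ rank3Table) (h : r.semistableB = true) :
    r.curve.IsSemistable ℤ :=
  (isSemistable_iff_semistableB hr).mpr h

/-- … and over `𝓞 ℚ` (the carrier of Serre's Prop. 21 in the tree;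
`isSemistable_ringOfIntegers_of_isSemistable_int`). [cite: Silverman1994, IV.10.2] -/
theorem isSemistable_ringOfIntegers_of_mem {r : Rank3Row} (hr : r ∈ rank3Table)
    (h : r.semistableB = true) : r.curve.IsSemistable (𝓞 ℚ) := by
  haveI := isElliptic_of_mem hr
  exact isSemistable_ringOfIntegers_of_isSemistable_int r.curve (isSemistable_of_mem hr h)

/-- The `4 892` failing rows are NOT semistable (some `p² ∣ N`: additive reduction at `p`).
[cite: Silverman1994, IV.10.2] -/
theorem not_isSemistable_of_mem {r : Rank3Row} (hr : r ∈ rank3Table) (h : r.semistableB = false) :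
    ¬ r.curve.IsSemistable ℤ := by
  rw [isSemistable_iff_semistableB hr, h]
  exact Bool.false_ne_true

/-- **KERNEL CENSUS**: exactly `4 595` of the `9 487` rank-3 census curves are semistable.
[cite: CremonaAlgorithms1997, Tables] -/
theorem rank3Table_countP_semistableB : rank3Table.countP Rank3Row.semistableB = 4595 := by
  decide +kernel

/-- **KERNEL CENSUS**: exactly `4 892` of the `9 487` rank-3 census curves are not semistable.
[cite: CremonaAlgorithms1997, Tables] -/
theorem rank3Table_countP_not_semistableB :
    rank3Table.countP (fun r => !r.semistableB) = 4892 := by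
  decide +kernel

/-- The six CM rows fail the test (CM curves over `ℚ` are never semistable; here read off `N`).
[cite: CremonaAlgorithms1997, Tables] -/
theorem cmRows_semistableB :
    cmRows.map (fun r => (r.label, r.semistableB)) =
      [("309123a1", false), ("309123a2", false), ("430336d1", false), ("430336d2", false),
        ("471969b1", false), ("471969b2", false)] := by
  decide +kernel

/-- A CM row is not semistable. [cite: Silverman1994, IV.10.2] -/
theorem not_isSemistable_of_mem_cmRows {r : Rank3Row} (hr : r ∈ cmRows) : ¬ r.curve.IsSemistable ℤ := by
  refine not_isSemistable_of_mem (mem_rank3Table_of_mem_cmRows hr) ?_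
  have h := congrArg (fun l => (r.label, r.semistableB) ∈ l) cmRows_semistableB
  simp only [List.mem_map, eq_iff_iff] at h
  have h' : (r.label, r.semistableB) ∈ [("309123a1", false), ("309123a2", false), ("430336d1", false),
      ("430336d2", false), ("471969b1", false), ("471969b2", false)] := h.mp ⟨r, hr, rfl⟩
  simp only [List.mem_cons, Prod.mk.injEq, List.not_mem_nil, or_false] at h'
  rcases h' with h' | h' | h' | h' | h' | h' <;> exact h'.2

/-- Row `0` (`5077a1`, `N = 5077` prime) passes: semistable. [cite: BuhlerGrossZagier1985, §1 eq. (2)] -/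
theorem rank3Table_head_semistableB :
    (rank3Table.head?.map fun r => (r.label, r.N, r.semistableB)) = some ("5077a1", 5077, true) := by
  decide +kernel

/-! ### §3 Row `0` by name, and the summary -/

/-- Row `0` passes the test (kernel); its curve is `Curve5077a.E` (`curve_row0_eq`). [cite: CremonaAlgorithms1997, Tables] -/
theorem rank3Table_row0_semistableB :
    (rank3Table[0]'(by rw [rank3Table_length]; decide)).semistableB = true := by
  decide +kernel

/-- **`5077a1` (`Curve5077a.E : y² + y = x³ − 7x + 6`, `N = 5077` prime) is semistable**, hypothesis-free.
[cite: BuhlerGrossZagier1985, §1 eq. (2)] [cite: Silverman1994, IV.10.2] -/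
theorem curve5077a_isSemistable : Curve5077a.E.IsSemistable ℤ := by
  rw [← curve_row0_eq]
  exact isSemistable_of_mem (List.getElem_mem _) rank3Table_row0_semistableB

/-- **THE SEMISTABILITY CENSUS OF THE RANK-3 TABLE** (summary, hypothesis-free): on `rank3Table` (all
`9 487` curves of rank `3` and conductor `< 500 000`), `IsSemistable ℤ ↔ semistableB` per row; `4 595`
rows pass and `4 892` fail; the six CM rows fail; `5077a1` passes. HONEST FRAMING: a census instrument;
no claim on BSD in rank ≥ 2. [cite: Silverman1994, IV.10.2] [cite: CremonaAlgorithms1997, Tables] -/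
theorem rank3_semistableCensus :
    (∀ r ∈ rank3Table, r.curve.IsSemistable ℤ ↔ r.semistableB = true) ∧
    rank3Table.countP Rank3Row.semistableB = 4595 ∧
    rank3Table.countP (fun r => !r.semistableB) = 4892 ∧
    (∀ r ∈ cmRows, ¬ r.curve.IsSemistable ℤ) ∧
    Curve5077a.E.IsSemistable ℤ :=
  ⟨fun _ hr => isSemistable_iff_semistableB hr, rank3Table_countP_semistableB,
    rank3Table_countP_not_semistableB, fun _ hr => not_isSemistable_of_mem_cmRows hr,
    curve5077a_isSemistable⟩

end Summit.BirchSwinnertonDyer.BirchSwinnertonDyer.Rank2Observatory
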